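import Mathlib
import Summits.ValiantsHypothesis.ValiantsHypothesis.Theses.ValuativeGCT
import Literature.Computability.AlgebraicComplexity.OrbitClosureWeights
import Literature.NumberTheory.DiophantineGeometry.SchurWeylPlethysmKroneckerBoundProofs
import Literature.NumberTheory.DiophantineGeometry.SchurWeylPlethysmOrbitWeightsProofs
import Literature.Computability.AlgebraicComplexity.GCTObstructionsWeightForm
import Literature.Computability.AlgebraicComplexity.CoordRepRational
import Literature.Computability.AlgebraicComplexity.MultiplicityObstructionsProofs
import Literature.NumberTheory.DiophantineGeometry.GLHighestWeightMultiplicityProofs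
import Summits.ValiantsHypothesis.ValiantsHypothesis.Theorems.ValuativeGCTCutBitesHwExtraction
/-!
# Bridge from a dimension gap to a crux-weight witness (B6)

Stub `stub_bottomBridge` of line `skew-restriction-rank` for crux `ValuativeGCT.ValuativeFlip`
(stmt-ValiantsHypothesis-12624), bottom-of-the-window decomposition (second lead, 2026-08-16).

`W = ℂ^{n×n}`, `R = ℂ[End W] = MvPolynomial (MatIdx n × MatIdx n) ℂ` (variables `X (j, i)`, row slot `j`,
matrix position `i`).  The crux's Borel clause is semi-invariance for the LEFT translation
`(g · G)(A) = G(g⁻¹ A)`, i.e. `X (j, i) ↦ ∑ l, (g⁻¹) j l • X (l, i)`.  Given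

* a counting lemma `hcount` for finite-dimensional rational `GL`-representations (a dimension gap forces a
  gap of some highest-weight multiplicity), and
* a dimension gap `hgap` between the explicit det-side module `M' = Hom_{nδ} ⊓ SAND ⊓ TR` (degree `nδ`,
  row-wise unimodular sandwich invariants, row-wise transpose invariants) and the per-side image
  `genericOrbitMap_{per_n} (ℂ[Sym^n]_δ) ≅ ℂ[Δ_n(per_n)]_δ`,

we produce `λ ⊢ nδ` with `≤ n²` parts and `dim (M' ⊓ HWSP(λ)) < mult_{λ*} ℂ[Δ_n(per_n)]`:
left translation makes `M'` a finite-dimensional rational representation (built inside `sb_bridge`, no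
definitions; stability `sb_stable`, rationality via `hwx_exists_eval_eq_apply_leftAct`), whose highest-weight space
of weight `χ` is `M' ⊓ HWSP(χ)`; `hcount` against the degree piece `orbitCoordRepDeg per_n n δ`
(dimension = that of the generic-orbit image by `orbitCoordToPoly_injective`) gives `χ`; a nonzero
highest-weight vector in the degree-`δ` piece pins `χ = λ*` with `λ ⊢ nδ`
(`exists_eq_toMatIdx_of_hasHighestWeight_paddedPerOrbitRep`, `size_eq_of_mem_orbitCoordRingDeg_of_mem_highestWeightSpace`)
and `hwMultiplicity (degree piece) ≤ orbitMultiplicity` (`sb_perSide`). BLMW 2011 §5.2; Goodman–Wallach §3.2, §4.1.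
[folklore]
-/

-- `Summit.ValiantsHypothesis.ValiantsHypothesis.…` is the tree's mandated single-conjunct layout (Sub = Summit).
set_option linter.dupNamespace false

namespace Summit.ValiantsHypothesis.ValiantsHypothesis.Theorems.ValuativeFlip

open MvPolynomial
open scoped BigOperators Matrix
open Literature.NumberTheory.DiophantineGeometry
open Literature.Computability.AlgebraicComplexity
open Summit.ValiantsHypothesis.ValiantsHypothesis.Theorems.CutBitesAdjugate

noncomputable section

/-! ### Stability of the explicit det-side module under left translation -/

section Stable

variable {n : ℕ}

/-- Left translation commutes with the row-wise sandwich substitution `X (j, (a,b)) ↦ ∑_{(c,d)} P a c Q d b • X (j, (c,d))`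
(the two substitutions act in different indices). [folklore] -/
theorem sb_leftAct_sandwich_comm (B : Matrix (MatIdx n) (MatIdx n) ℂ) (P Q : Matrix (Fin n) (Fin n) ℂ)
    (G : MvPolynomial (MatIdx n × MatIdx n) ℂ) :
    MvPolynomial.aeval (R := ℂ) (fun p : MatIdx n × MatIdx n =>
        ∑ l : MatIdx n, B p.1 l • (X (l, p.2) : MvPolynomial (MatIdx n × MatIdx n) ℂ))
      ((MvPolynomial.aeval fun p : MatIdx n × MatIdx n =>
          ∑ l : MatIdx n, (P (ofLex p.2).1 (ofLex l).1 * Q (ofLex l).2 (ofLex p.2).2) •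
            (MvPolynomial.X (p.1, l) : MvPolynomial (MatIdx n × MatIdx n) ℂ)) G) =
      (MvPolynomial.aeval fun p : MatIdx n × MatIdx n =>
          ∑ l : MatIdx n, (P (ofLex p.2).1 (ofLex l).1 * Q (ofLex l).2 (ofLex p.2).2) •
            (MvPolynomial.X (p.1, l) : MvPolynomial (MatIdx n × MatIdx n) ℂ))
        (MvPolynomial.aeval (R := ℂ) (fun p : MatIdx n × MatIdx n =>
          ∑ l : MatIdx n, B p.1 l • (X (l, p.2) : MvPolynomial (MatIdx n × MatIdx n) ℂ)) G) :=
  hwx_leftAct_rightAct_comm B (fun l i : MatIdx n => P (ofLex i).1 (ofLex l).1 * Q (ofLex l).2 (ofLex i).2) G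

/-- Left translation commutes with the row-wise transpose substitution `X (j, (a,b)) ↦ X (j, (b,a))`. [folklore] -/
theorem sb_leftAct_transpose_comm (B : Matrix (MatIdx n) (MatIdx n) ℂ) (G : MvPolynomial (MatIdx n × MatIdx n) ℂ) :
    MvPolynomial.aeval (R := ℂ) (fun p : MatIdx n × MatIdx n =>
        ∑ l : MatIdx n, B p.1 l • (X (l, p.2) : MvPolynomial (MatIdx n × MatIdx n) ℂ))
      ((MvPolynomial.aeval fun p : MatIdx n × MatIdx n =>
          (MvPolynomial.X (p.1, toLex ((ofLex p.2).2, (ofLex p.2).1)) : MvPolynomial (MatIdx n × MatIdx n) ℂ)) G) =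
      (MvPolynomial.aeval fun p : MatIdx n × MatIdx n =>
          (MvPolynomial.X (p.1, toLex ((ofLex p.2).2, (ofLex p.2).1)) : MvPolynomial (MatIdx n × MatIdx n) ℂ))
        (MvPolynomial.aeval (R := ℂ) (fun p : MatIdx n × MatIdx n =>
          ∑ l : MatIdx n, B p.1 l • (X (l, p.2) : MvPolynomial (MatIdx n × MatIdx n) ℂ)) G) := by
  have h : (MvPolynomial.aeval (R := ℂ) (fun p : MatIdx n × MatIdx n =>
        ∑ l : MatIdx n, B p.1 l • (X (l, p.2) : MvPolynomial (MatIdx n × MatIdx n) ℂ))).comp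
      (MvPolynomial.aeval fun p : MatIdx n × MatIdx n =>
          (MvPolynomial.X (p.1, toLex ((ofLex p.2).2, (ofLex p.2).1)) : MvPolynomial (MatIdx n × MatIdx n) ℂ)) =
      (MvPolynomial.aeval fun p : MatIdx n × MatIdx n =>
          (MvPolynomial.X (p.1, toLex ((ofLex p.2).2, (ofLex p.2).1)) : MvPolynomial (MatIdx n × MatIdx n) ℂ)).comp
      (MvPolynomial.aeval (R := ℂ) (fun p : MatIdx n × MatIdx n =>
          ∑ l : MatIdx n, B p.1 l • (X (l, p.2) : MvPolynomial (MatIdx n × MatIdx n) ℂ))) := by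
    refine MvPolynomial.algHom_ext fun p => ?_
    simp only [AlgHom.comp_apply, aeval_X, map_sum, map_smul]
  exact AlgHom.congr_fun h G

/-- The explicit det-side module `Hom_D ⊓ (SAND ⊓ TR)` is stable under every left translation: left
translation preserves degrees and commutes with the sandwich and transpose substitutions. [folklore] -/
theorem sb_stable (n D : ℕ) (B : Matrix (MatIdx n) (MatIdx n) ℂ) (F : MvPolynomial (MatIdx n × MatIdx n) ℂ)
    (hF : F ∈ MvPolynomial.homogeneousSubmodule (MatIdx n × MatIdx n) ℂ D ⊓
        ((⨅ (P : Matrix (Fin n) (Fin n) ℂ) (Q : Matrix (Fin n) (Fin n) ℂ) (_ : P.det = 1) (_ : Q.det = 1),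
            LinearMap.ker ((MvPolynomial.aeval fun p : MatIdx n × MatIdx n =>
                ∑ l : MatIdx n, (P (ofLex p.2).1 (ofLex l).1 * Q (ofLex l).2 (ofLex p.2).2) •
                  (MvPolynomial.X (p.1, l) : MvPolynomial (MatIdx n × MatIdx n) ℂ)).toLinearMap -
              (LinearMap.id : MvPolynomial (MatIdx n × MatIdx n) ℂ →ₗ[ℂ] MvPolynomial (MatIdx n × MatIdx n) ℂ))) ⊓
          LinearMap.ker ((MvPolynomial.aeval fun p : MatIdx n × MatIdx n =>
              (MvPolynomial.X (p.1, toLex ((ofLex p.2).2, (ofLex p.2).1)) :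
                MvPolynomial (MatIdx n × MatIdx n) ℂ)).toLinearMap -
            (LinearMap.id : MvPolynomial (MatIdx n × MatIdx n) ℂ →ₗ[ℂ] MvPolynomial (MatIdx n × MatIdx n) ℂ)))) :
    MvPolynomial.aeval (R := ℂ) (fun p : MatIdx n × MatIdx n =>
        ∑ l : MatIdx n, B p.1 l • (X (l, p.2) : MvPolynomial (MatIdx n × MatIdx n) ℂ)) F ∈
      MvPolynomial.homogeneousSubmodule (MatIdx n × MatIdx n) ℂ D ⊓
        ((⨅ (P : Matrix (Fin n) (Fin n) ℂ) (Q : Matrix (Fin n) (Fin n) ℂ) (_ : P.det = 1) (_ : Q.det = 1),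
            LinearMap.ker ((MvPolynomial.aeval fun p : MatIdx n × MatIdx n =>
                ∑ l : MatIdx n, (P (ofLex p.2).1 (ofLex l).1 * Q (ofLex l).2 (ofLex p.2).2) •
                  (MvPolynomial.X (p.1, l) : MvPolynomial (MatIdx n × MatIdx n) ℂ)).toLinearMap -
              (LinearMap.id : MvPolynomial (MatIdx n × MatIdx n) ℂ →ₗ[ℂ] MvPolynomial (MatIdx n × MatIdx n) ℂ))) ⊓
          LinearMap.ker ((MvPolynomial.aeval fun p : MatIdx n × MatIdx n =>
              (MvPolynomial.X (p.1, toLex ((ofLex p.2).2, (ofLex p.2).1)) :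
                MvPolynomial (MatIdx n × MatIdx n) ℂ)).toLinearMap -
            (LinearMap.id : MvPolynomial (MatIdx n × MatIdx n) ℂ →ₗ[ℂ] MvPolynomial (MatIdx n × MatIdx n) ℂ))) := by
  obtain ⟨hFh, hFs, hFt⟩ := (Submodule.mem_inf.mp hF).imp_right Submodule.mem_inf.mp
  refine Submodule.mem_inf.mpr ⟨?_, Submodule.mem_inf.mpr ⟨?_, ?_⟩⟩
  · exact (mem_homogeneousSubmodule _ _).mpr
      (hwx_leftAct_isHomogeneous B ((mem_homogeneousSubmodule _ _).mp hFh))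
  · simp only [Submodule.mem_iInf, LinearMap.mem_ker, LinearMap.sub_apply, LinearMap.id_coe, id_eq,
      AlgHom.toLinearMap_apply, sub_eq_zero] at hFs ⊢
    intro P Q hP hQ
    rw [← sb_leftAct_sandwich_comm, hFs P Q hP hQ]
  · simp only [LinearMap.mem_ker, LinearMap.sub_apply, LinearMap.id_coe, id_eq, AlgHom.toLinearMap_apply,
      sub_eq_zero] at hFt ⊢
    rw [← sb_leftAct_transpose_comm, hFt]

end Stable

/-! ### The per side: degree pieces of `ℂ[Δ_n(per_n)]` -/

/-- The generic-orbit image of the degree-`δ` forms has the dimension of the degree-`δ` piece of the coordinate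
ring of the orbit closure: `genericOrbitMap = orbitCoordToPoly ∘ mk` with `orbitCoordToPoly` injective
(`I(GL · f)` is the kernel of the generic orbit map). Mulmuley–Sohoni 2001 §4; BLMW 2011 §5.2. [folklore] -/
theorem sb_finrank_map_genericOrbitMap {σ : Type*} [Fintype σ] [LinearOrder σ] (f : MvPolynomial σ ℂ) (m δ : ℕ) :
    Module.finrank ℂ ↥((MvPolynomial.homogeneousSubmodule (DegIdx σ m) ℂ δ).map (genericOrbitMap f m).toLinearMap) =
      Module.finrank ℂ ↥(orbitCoordRingDeg f m δ) := by
  have hcomp : (genericOrbitMap f m).toLinearMap =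
      (orbitCoordToPoly f m).toLinearMap ∘ₗ (Ideal.Quotient.mkₐ ℂ (orbitVanishingIdeal f m)).toLinearMap :=
    LinearMap.ext fun F => by
      simp only [LinearMap.comp_apply, AlgHom.toLinearMap_apply, Ideal.Quotient.mkₐ_eq_mk, orbitCoordToPoly_mk]
  rw [hcomp, Submodule.map_comp]
  exact (LinearEquiv.finrank_eq
    (Submodule.equivMapOfInjective _ (orbitCoordToPoly_injective f m) (orbitCoordRingDeg f m δ))).symm

/-- A highest weight `χ` of positive multiplicity in the degree-`δ` piece of `ℂ[Δ_n(per_n)]` is `λ*` for a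
partition `λ ⊢ nδ` with `≤ n²` parts (`exists_eq_toMatIdx_of_hasHighestWeight_paddedPerOrbitRep`, the degree
pinned by `size_eq_of_mem_orbitCoordRingDeg_of_mem_highestWeightSpace`), and its multiplicity in the degree piece
is at most its multiplicity in the whole coordinate ring (`orbitMultiplicity`). BLMW 2011 §5.2. [folklore] -/
theorem sb_perSide (n : ℕ) [NeZero n] (δ : ℕ) {χ : Weight (MatIdx n)}
    (hχ : hwMultiplicity (orbitCoordRepDeg (paddedPerFormLex ℂ n n) n δ) χ ≠ 0) :
    ∃ lam : Nat.Partition (n * δ), lam.parts.card ≤ n * n ∧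
      χ = ((Weight.dualOfPartition (n * n) lam).toMatIdx : Weight (MatIdx n)) ∧
      hwMultiplicity (orbitCoordRepDeg (paddedPerFormLex ℂ n n) n δ) χ ≤
        orbitMultiplicity ℂ (paddedPerFormLex ℂ n n) n χ := by
  haveI := finiteDimensional_orbitCoordRingDeg (paddedPerFormLex ℂ n n) n δ
  obtain ⟨x, hx0, hx⟩ := (hasHighestWeight_iff_exists _ _).mp
    ((hasHighestWeight_iff_hwMultiplicity_ne_zero _ _).mpr hχ)
  have hx' : (x : OrbitCoordRing (paddedPerFormLex ℂ n n) n) ∈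
      highestWeightSpace (orbitCoordRep (paddedPerFormLex ℂ n n) n) χ :=
    (mem_highestWeightSpace_toRepresentation_iff (orbitCoordSubrep (paddedPerFormLex ℂ n n) n δ) χ x).mp hx
  have hx0' : (x : OrbitCoordRing (paddedPerFormLex ℂ n n) n) ≠ 0 := fun h =>
    hx0 (Subtype.ext (h.trans (Submodule.coe_zero (p := orbitCoordRingDeg (paddedPerFormLex ℂ n n) n δ)).symm))
  have hsize := size_eq_of_mem_orbitCoordRingDeg_of_mem_highestWeightSpace (paddedPerFormLex ℂ n n) x.2 hx' hx0'
  have hhw : HasHighestWeight (paddedPerOrbitRep ℂ n n) χ := (hasHighestWeight_iff_exists _ _).mpr ⟨_, hx0', hx'⟩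
  obtain ⟨d, lam, hlamN, rfl⟩ := exists_eq_toMatIdx_of_hasHighestWeight_paddedPerOrbitRep hhw
  have hd : n * d = n * δ := by
    have h := (size_toMatIdx_dualOfPartition n lam hlamN).symm.trans hsize
    exact_mod_cast neg_injective h
  obtain rfl : δ = d := (Nat.eq_of_mul_eq_mul_left (Nat.pos_of_ne_zero (NeZero.ne n)) hd).symm
  refine ⟨lam, hlamN, rfl, ?_⟩
  haveI := finiteDimensional_highestWeightSpace_orbitCoordRep_holds (k := ℂ) (paddedPerFormLex ℂ n n)
    (NeZero.ne n) ((Weight.dualOfPartition (n * n) lam).toMatIdx : Weight (MatIdx n))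
  have hle : (highestWeightSpace (orbitCoordRepDeg (paddedPerFormLex ℂ n n) n δ)
        ((Weight.dualOfPartition (n * n) lam).toMatIdx : Weight (MatIdx n))).map
          (orbitCoordRingDeg (paddedPerFormLex ℂ n n) n δ).subtype ≤
      highestWeightSpace (orbitCoordRep (paddedPerFormLex ℂ n n) n)
        ((Weight.dualOfPartition (n * n) lam).toMatIdx : Weight (MatIdx n)) := by
    rintro _ ⟨y, hy, rfl⟩
    exact (mem_highestWeightSpace_toRepresentation_iff (orbitCoordSubrep (paddedPerFormLex ℂ n n) n δ) _ y).mp hy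
  rw [hwMultiplicity, ← Submodule.finrank_map_subtype_eq]
  exact Submodule.finrank_mono hle

/-! ### The bridge -/

/-- **The bridge for a stable submodule.** For a left-translation-stable submodule `S` of a homogeneous piece of
`ℂ[End W]` whose dimension is smaller than that of the degree-`δ` piece of `ℂ[Δ_n(per_n)]`, the counting lemma
yields `λ ⊢ nδ` (`≤ n²` parts) with `dim (S ⊓ HWSP(λ)) < mult_{λ*} ℂ[Δ_n(per_n)]`. [folklore] -/
theorem sb_bridge
    (hcount : ∀ (σ : Type) [Fintype σ] [LinearOrder σ]
      (V : Type) [AddCommGroup V] [Module ℂ V] [FiniteDimensional ℂ V]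
      (V' : Type) [AddCommGroup V'] [Module ℂ V'] [FiniteDimensional ℂ V']
      (ρ : Representation ℂ (GL σ ℂ) V) (ρ' : Representation ℂ (GL σ ℂ) V'),
      IsRationalRep ρ → IsRationalRep ρ' → Module.finrank ℂ V' < Module.finrank ℂ V →
        ∃ χ : Weight σ, hwMultiplicity ρ' χ < hwMultiplicity ρ χ)
    (n : ℕ) [NeZero n] (δ D : ℕ) (S : Submodule ℂ (MvPolynomial (MatIdx n × MatIdx n) ℂ))
    (hSD : S ≤ MvPolynomial.homogeneousSubmodule (MatIdx n × MatIdx n) ℂ D)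
    (hS : ∀ B : Matrix (MatIdx n) (MatIdx n) ℂ, ∀ F ∈ S,
      MvPolynomial.aeval (R := ℂ) (fun p : MatIdx n × MatIdx n =>
        ∑ l : MatIdx n, B p.1 l • (X (l, p.2) : MvPolynomial (MatIdx n × MatIdx n) ℂ)) F ∈ S)
    (hgap : Module.finrank ℂ ↥S <
      Module.finrank ℂ ↥((MvPolynomial.homogeneousSubmodule (DegIdx (MatIdx n) n) ℂ δ).map
        (genericOrbitMap (paddedPerFormLex ℂ n n) n).toLinearMap)) :
    ∃ lam : Nat.Partition (n * δ), lam.parts.card ≤ n * n ∧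
      Module.finrank ℂ ↥(S ⊓
          (⨅ (g : Matrix.GeneralLinearGroup (MatIdx n) ℂ) (_ : IsUpperTriangular g),
              LinearMap.ker ((MvPolynomial.aeval fun p : MatIdx n × MatIdx n =>
                  ∑ l : MatIdx n, ((g⁻¹ : Matrix.GeneralLinearGroup (MatIdx n) ℂ) :
                    Matrix (MatIdx n) (MatIdx n) ℂ) p.1 l •
                      (MvPolynomial.X (l, p.2) : MvPolynomial (MatIdx n × MatIdx n) ℂ)).toLinearMap -
                weightChar ((Weight.dualOfPartition (n * n) lam).toMatIdx : Weight (MatIdx n)) g •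
                  (LinearMap.id : MvPolynomial (MatIdx n × MatIdx n) ℂ →ₗ[ℂ] MvPolynomial (MatIdx n × MatIdx n) ℂ)))) <
        orbitMultiplicity ℂ (paddedPerFormLex ℂ n n) n
          ((Weight.dualOfPartition (n * n) lam).toMatIdx : Weight (MatIdx n)) := by
  haveI : Module.Finite ℂ ↥(MvPolynomial.homogeneousSubmodule (MatIdx n × MatIdx n) ℂ D) :=
    finite_homogeneousSubmodule _ _ _
  haveI : FiniteDimensional ℂ ↥S := Submodule.finiteDimensional_of_le hSD
  haveI := finiteDimensional_orbitCoordRingDeg (paddedPerFormLex ℂ n n) n δ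
  -- the left translation representation `(g · G)(A) = G(g⁻¹ A)` on `S` (adapted from
  -- Theorems/ValuativeGCTCutBitesHwExtraction.lean, built inside the proof: no definitions)
  let ρ' : Representation ℂ (GL (MatIdx n) ℂ) ↥S :=
    { toFun := fun g => (MvPolynomial.aeval (R := ℂ) (fun q : MatIdx n × MatIdx n =>
          ∑ l : MatIdx n, ((g⁻¹ : GL (MatIdx n) ℂ) : Matrix (MatIdx n) (MatIdx n) ℂ) q.1 l •
            (X (l, q.2) : MvPolynomial (MatIdx n × MatIdx n) ℂ))).toLinearMap.restrict (hS _)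
      map_one' := LinearMap.ext fun v => Subtype.ext (by
        simp only [LinearMap.coe_restrict_apply, AlgHom.toLinearMap_apply, Module.End.one_apply, inv_one,
          Units.val_one, hwx_leftAct_one])
      map_mul' := fun g h => LinearMap.ext fun v => Subtype.ext (by
        simp only [LinearMap.coe_restrict_apply, AlgHom.toLinearMap_apply, Module.End.mul_apply,
          hwx_leftAct_leftAct, mul_inv_rev, Units.val_mul]) }
  have hρ'v : ∀ (g : GL (MatIdx n) ℂ) (v : ↥S), ((ρ' g v : ↥S) : MvPolynomial (MatIdx n × MatIdx n) ℂ) =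
      MvPolynomial.aeval (R := ℂ) (fun q : MatIdx n × MatIdx n =>
        ∑ l : MatIdx n, ((g⁻¹ : GL (MatIdx n) ℂ) : Matrix (MatIdx n) (MatIdx n) ℂ) q.1 l •
          (X (l, q.2) : MvPolynomial (MatIdx n × MatIdx n) ℂ)) (v : MvPolynomial (MatIdx n × MatIdx n) ℂ) :=
    fun _ _ => rfl
  -- rationality: matrix coefficients are polynomials in the entries of `g⁻¹`
  have hρ'rat : IsRationalRep ρ' := by
    refine isRationalRep_of_forall_exists_eval_inv fun v φ => ?_
    obtain ⟨ψ, hψ⟩ := LinearMap.exists_extend φ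
    obtain ⟨Q, hQ⟩ := hwx_exists_eval_eq_apply_leftAct (v : MvPolynomial (MatIdx n × MatIdx n) ℂ) ψ
    refine ⟨Q, fun g => ?_⟩
    rw [← hQ ((g⁻¹ : GL (MatIdx n) ℂ) : Matrix (MatIdx n) (MatIdx n) ℂ), ← hρ'v, ← hψ]
    rfl
  -- the counting lemma against the degree-`δ` piece of `ℂ[Δ_n(per_n)]`
  rw [sb_finrank_map_genericOrbitMap] at hgap
  obtain ⟨χ, hχ⟩ := hcount (MatIdx n) ↥(orbitCoordRingDeg (paddedPerFormLex ℂ n n) n δ) ↥S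
    (orbitCoordRepDeg (paddedPerFormLex ℂ n n) n δ) ρ'
    (isRationalRep_orbitCoordRepDeg _ n δ) hρ'rat hgap
  obtain ⟨lam, hlamN, rfl, hle⟩ := sb_perSide n δ (lt_of_le_of_lt (Nat.zero_le _) hχ).ne'
  refine ⟨lam, hlamN, ?_⟩
  -- the highest-weight space of `ρ'` of weight `λ*` is `S ⊓ HWSP(λ)`
  rw [← Submodule.map_comap_subtype, Submodule.finrank_map_subtype_eq]
  refine lt_of_eq_of_lt ?_ (lt_of_lt_of_le hχ hle)
  rw [hwMultiplicity]
  refine congrArg (fun T : Submodule ℂ ↥S => Module.finrank ℂ ↥T) (Submodule.ext fun v => ?_)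
  simp only [mem_highestWeightSpace_iff, Submodule.mem_comap, Submodule.mem_iInf, LinearMap.mem_ker,
    LinearMap.sub_apply, LinearMap.smul_apply, LinearMap.id_coe, id_eq, AlgHom.toLinearMap_apply,
    Submodule.subtype_apply, sub_eq_zero]
  refine forall₂_congr fun g _ => ?_
  rw [Subtype.ext_iff, Submodule.coe_smul, hρ'v]

/-- **B6, the bottom bridge** (stub `stub_bottomBridge` of line skew-restriction-rank, crux
stmt-ValiantsHypothesis-12624). Given the counting lemma `hcount` for finite-dimensional rational
`GL`-representations and a dimension gap `hgap` between the explicit det-side module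
`Hom_{nδ} ⊓ SAND ⊓ TR ⊆ ℂ[End ℂ^{n×n}]` (degree `nδ`, row-wise unimodular sandwich invariants, row-wise transpose
invariants) and the generic-orbit image of `ℂ[Sym^n]_δ` for `per_n` (`≅ ℂ[Δ_n(per_n)]_δ`), there is a partition
`λ ⊢ nδ` with `≤ n²` parts such that the subspace of `Hom_{nδ} ⊓ SAND ⊓ TR` of `B`-semi-invariants of weight
`λ* = (dualOfPartition (n*n) λ).toMatIdx` for the left translation `G ↦ (A ↦ G(g⁻¹A))` has dimension strictly
smaller than the multiplicity of `λ*` in `ℂ[Δ_n(per_n)]`. Proof: `sb_bridge` for `S = Hom_{nδ} ⊓ SAND ⊓ TR`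
(stable by `sb_stable`). BLMW 2011 §5.2; Goodman–Wallach §3.2, §4.1. [folklore] -/
theorem stub_bottomBridge
    (hcount : ∀ (σ : Type) [Fintype σ] [LinearOrder σ]
      (V : Type) [AddCommGroup V] [Module ℂ V] [FiniteDimensional ℂ V]
      (V' : Type) [AddCommGroup V'] [Module ℂ V'] [FiniteDimensional ℂ V']
      (ρ : Representation ℂ (GL σ ℂ) V) (ρ' : Representation ℂ (GL σ ℂ) V'),
      IsRationalRep ρ → IsRationalRep ρ' → Module.finrank ℂ V' < Module.finrank ℂ V →
        ∃ χ : Weight σ, hwMultiplicity ρ' χ < hwMultiplicity ρ χ)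
    (n : ℕ) [NeZero n] (δ : ℕ)
    (hgap : Module.finrank ℂ ↥(MvPolynomial.homogeneousSubmodule (MatIdx n × MatIdx n) ℂ (n * δ) ⊓
        ((⨅ (P : Matrix (Fin n) (Fin n) ℂ) (Q : Matrix (Fin n) (Fin n) ℂ) (_ : P.det = 1) (_ : Q.det = 1),
            LinearMap.ker ((MvPolynomial.aeval fun p : MatIdx n × MatIdx n =>
                ∑ l : MatIdx n, (P (ofLex p.2).1 (ofLex l).1 * Q (ofLex l).2 (ofLex p.2).2) •
                  (MvPolynomial.X (p.1, l) : MvPolynomial (MatIdx n × MatIdx n) ℂ)).toLinearMap -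
              (LinearMap.id : MvPolynomial (MatIdx n × MatIdx n) ℂ →ₗ[ℂ] MvPolynomial (MatIdx n × MatIdx n) ℂ))) ⊓
          LinearMap.ker ((MvPolynomial.aeval fun p : MatIdx n × MatIdx n =>
              (MvPolynomial.X (p.1, toLex ((ofLex p.2).2, (ofLex p.2).1)) :
                MvPolynomial (MatIdx n × MatIdx n) ℂ)).toLinearMap -
            (LinearMap.id : MvPolynomial (MatIdx n × MatIdx n) ℂ →ₗ[ℂ] MvPolynomial (MatIdx n × MatIdx n) ℂ)))) <
      Module.finrank ℂ ↥((MvPolynomial.homogeneousSubmodule (DegIdx (MatIdx n) n) ℂ δ).map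
        (genericOrbitMap (paddedPerFormLex ℂ n n) n).toLinearMap)) :
    ∃ lam : Nat.Partition (n * δ), lam.parts.card ≤ n * n ∧
      Module.finrank ℂ ↥(MvPolynomial.homogeneousSubmodule (MatIdx n × MatIdx n) ℂ (n * δ) ⊓
          ((⨅ (P : Matrix (Fin n) (Fin n) ℂ) (Q : Matrix (Fin n) (Fin n) ℂ) (_ : P.det = 1) (_ : Q.det = 1),
              LinearMap.ker ((MvPolynomial.aeval fun p : MatIdx n × MatIdx n =>
                  ∑ l : MatIdx n, (P (ofLex p.2).1 (ofLex l).1 * Q (ofLex l).2 (ofLex p.2).2) •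
                    (MvPolynomial.X (p.1, l) : MvPolynomial (MatIdx n × MatIdx n) ℂ)).toLinearMap -
                (LinearMap.id : MvPolynomial (MatIdx n × MatIdx n) ℂ →ₗ[ℂ] MvPolynomial (MatIdx n × MatIdx n) ℂ))) ⊓
            LinearMap.ker ((MvPolynomial.aeval fun p : MatIdx n × MatIdx n =>
                (MvPolynomial.X (p.1, toLex ((ofLex p.2).2, (ofLex p.2).1)) :
                  MvPolynomial (MatIdx n × MatIdx n) ℂ)).toLinearMap -
              (LinearMap.id : MvPolynomial (MatIdx n × MatIdx n) ℂ →ₗ[ℂ] MvPolynomial (MatIdx n × MatIdx n) ℂ))) ⊓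
          (⨅ (g : Matrix.GeneralLinearGroup (MatIdx n) ℂ) (_ : IsUpperTriangular g),
              LinearMap.ker ((MvPolynomial.aeval fun p : MatIdx n × MatIdx n =>
                  ∑ l : MatIdx n, ((g⁻¹ : Matrix.GeneralLinearGroup (MatIdx n) ℂ) :
                    Matrix (MatIdx n) (MatIdx n) ℂ) p.1 l •
                      (MvPolynomial.X (l, p.2) : MvPolynomial (MatIdx n × MatIdx n) ℂ)).toLinearMap -
                weightChar ((Weight.dualOfPartition (n * n) lam).toMatIdx : Weight (MatIdx n)) g •
                  (LinearMap.id : MvPolynomial (MatIdx n × MatIdx n) ℂ →ₗ[ℂ] MvPolynomial (MatIdx n × MatIdx n) ℂ)))) <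
        orbitMultiplicity ℂ (paddedPerFormLex ℂ n n) n
          ((Weight.dualOfPartition (n * n) lam).toMatIdx : Weight (MatIdx n)) := by
  exact sb_bridge hcount n δ (n * δ) _ inf_le_left (sb_stable n (n * δ)) hgap


end

end Summit.ValiantsHypothesis.ValiantsHypothesis.Theorems.ValuativeFlip
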